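import Summits.HodgeConjecture.HodgeConjecture.Theorems.F0P3bArchCohomologicalMembers   -- ★ p811109 (X1): `archAPacketRealised_holds`, `archCohomologicalMembers_holds`
import Literature.RepresentationTheory.GKModuleIrrClass                                 -- ★ p816930: `GKIrrep`, `GKIrrClass`, `GKIrrClass.mk`∕`ofModule`, `mk_eq_mk_iff`
import HarnessLib

/-!
# FLOOR-0 P3b «ENGINE local packets» — row X1′: the archimedean `H¹`-members `J^±` AS CLASSES of record (`GKIrrClass` currency)

Cell hodgecm-mathlib (D-0151), FLOOR 0, crux item H413 = stmt-HodgeConjecture-24833; sub-line `Cruxes/H413/Lines/F0_LocalAPackets.lean` (ed. 4.4,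
SORRY-FREE).  Row X1′ of PLAN-P3b v8 §1 ∕ F0P3b-plan (g7) 2026-08-31T10:39:03Z, answering F0P3-plan (g5)'s RULING (V32)(3) «`packInf₀` waits for P3b's
archimedean-packet carrier in `GKIrrClass` currency — name the term or say posit»: the NON-TEMPERED MEMBER `πⁿ(ξ_ι) = J^±_φ` of the archimedean A-packet
`Π(ξ_ι) = {πⁿ(ξ_ι), πˢ(ξ_ι)}` [Rogawski1990 §12.3 p. 178, Prop. 12.3.3] is NAMED here as a canonical isomorphism class; the second member `πˢ(ξ_ι) = D^∓_φ`
(a discrete series representation) is NOT constructed in the tree and stays POSITED by the rung-4 integrator.  PROOF∕helper lane (`--supports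
stmt-HodgeConjecture-24833`); one `def` with body + read-backs; no `sorry`, no instance declaration, no notation, no named fact.

## Content
From the two kernel-closed EXITS of the line re-exported by ★ X1 `Theorems/F0P3bArchCohomologicalMembers.lean` (p811109) —
EXIT 1 `archAPacketRealised_holds` (for each sign `δ = ±1` an irreducible unitary cohomological `(𝔲(2,1), K)`-module with a non-zero degree-one class of type
`δ`) and EXIT 2 `archCohomologicalMembers_holds` (the two are inequivalent, and every irreducible unitary cohomological module with a non-zero class of type
`δ` is `(𝔤, K)`-equivalent to the type-`δ` one) — and ★ `GKIrrClass` (p816930, the rung-4 archimedean class type `Cinf = GKIrrClass (uFormGroup (Fin 2) (Fin 1))`):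
* `exists_gkIrrep_of_sign` — EXIT 1 re-bundled: a `GKIrrep G21` carrying `IsCohUnitaryIrrep` and a non-zero type-`δ` degree-one class;
* `areGKEquivalent_of_upqType_ne_bot` — EXIT 2 rigidity as a two-sided statement: ANY two such modules of the same type `δ` are `(𝔤, K)`-equivalent;
* **`archDegOneClass δ hδ : GKIrrClass G21`** — THE CLASS `[J^δ]` (of a chosen witness of EXIT 1; canonical by rigidity):
  `archDegOneClass_spec` (it is the class of an irreducible unitary cohomological module with a non-zero type-`δ` class),
  **`ofModule_eq_archDegOneClass`** (every such module has class `archDegOneClass δ`), `archDegOneClass_one_ne_neg_one` (`[J⁺] ≠ [J⁻]`, T6a purity),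
  `archDegOneClass_injective` (the sign is determined by the class), **`eq_of_ofModule_eq_archDegOneClass`** (a module of class `[J^δ]` carries non-zero
  degree-one classes of type `δ` ONLY — the `πⁿ`-half of the integrator's law `ArchPacketCoh` as a THEOREM).

Sign convention = T6's: `δ` is the TYPE index of ★ `upqTypeClasses ρK ρ𝔤 _ 1 δ` (`δ = 1` ↔ type `(1,0)`, `δ = −1` ↔ type `(0,1)`); the print dictionary
«`πⁿ(ξ_ι) = J⁺_φ` iff `ξ_ι = ξ(b,a,c)`, `= J⁻_φ` iff `ξ_ι = ξ(a,c,b)`» [p. 178 ll. 12–15] is NOT asserted here (it is the integrator's `sgnInf`∕`ArchSignRecipe` business).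

HONEST LABEL: HC_CM is proved only modulo the printed citations until rung 0 closes; this file names classes of two kernel-constructed modules and proves
read-backs of EXIT 1∕EXIT 2 — the archimedean character identity [Prop. 12.3.3 (a)] and the member `πˢ(ξ_ι)` are NOT here.

## References
* [Rogawski1990] J. Rogawski, *Automorphic Representations of Unitary Groups in Three Variables*, Annals of Math. Studies 123 (1990) — §12.3 p. 178
  (`πⁿ(ξ) = J^±_φ`, `πˢ(ξ) = D^∓_φ`, Prop. 12.3.3), Prop. 15.2.1 (b) p. 244 (the cohomological unitary representations with `H¹ ≠ 0`).
* [BorelWallach2000] A. Borel, N. Wallach, *Continuous Cohomology, Discrete Subgroups, and Representations of Reductive Groups*, 2nd ed., AMS 2000 —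
  I §4.3 (infinitesimal equivalence), VI Thm 4.11.
* [KnappVogan1995] A. Knapp, D. Vogan, *Cohomological Induction and Unitary Representations*, Princeton 1995 — §II.4 (isomorphism classes of `(𝔤, K)`-modules).
-/

set_option autoImplicit false
set_option linter.dupNamespace false

noncomputable section

namespace Summit.HodgeConjecture.HodgeConjecture.Cruxes.H413.F0P3bArchDegOneClass

open Literature.NumberTheory.Automorphic
open Literature.RepresentationTheory.BorelWallach2000
open Literature.RepresentationTheory.KonnoKonno2007 Literature.RepresentationTheory.KonnoKonno2007.RealDualPair
open Literature.RepresentationTheory.KonnoKonno2007.RealDualPair.UForm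
open Summit.HodgeConjecture.HodgeConjecture.Cruxes.H413.F0P3bArchDegOnePackage
open Summit.HodgeConjecture.HodgeConjecture.Cruxes.H413.F0P3bLocalAPacketsDefs
open Summit.HodgeConjecture.HodgeConjecture.Cruxes.H413.F0P3bArchCohomologicalMembers

-- Mathlib idiom (as in ★ `GKModuleIrrClass`, the `Upq*` files, X1): commutator bracket on `Module.End`
attribute [local instance 100] LieRing.ofAssociativeRing

/-! ## §1 EXIT 1 re-bundled and EXIT 2 as two-sided rigidity -/

/-- **EXIT 1, bundled**: for each sign `δ = ±1` there is an irreducible `(𝔲(2,1), K)`-module (as a ★ `GKIrrep G21`) which is unitary cohomological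
with a non-zero degree-one class of type `δ` (★ `archAPacketRealised_holds`). [cite: Rogawski1990, Prop. 15.2.1 (b)] -/
theorem exists_gkIrrep_of_sign (δ : ℤ) (hδ : δ = 1 ∨ δ = -1) :
    ∃ (r : GKIrrep G21) (h : IsCohUnitaryIrrep r.ρK r.ρ𝔤), upqTypeClasses r.ρK r.ρ𝔤 h.gk.ad_compat 1 δ ≠ ⊥ := by
  obtain ⟨V, _, _, ρK, ρ𝔤, h, hne⟩ := archAPacketRealised_holds δ hδ
  exact ⟨⟨V, ρK, ρ𝔤, h.gk, h.irred⟩, h, hne⟩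

/-- **EXIT 2 rigidity, two-sided**: any two irreducible unitary cohomological `(𝔲(2,1), K)`-modules with non-zero degree-one classes of the SAME type
`δ = ±1` are `(𝔤, K)`-equivalent (both are equivalent to the type-`δ` member of ★ `archCohomologicalMembers_holds`; ★ `AreGKEquivalent.trans`∕`symm'`).
[cite: Rogawski1990, Prop. 15.2.1 (b); BorelWallach2000, VI Thm 4.11] -/
theorem areGKEquivalent_of_upqType_ne_bot {V : Type} [AddCommGroup V] [Module ℂ V]
    {ρK : Representation ℂ G21.maximalCompact V} {ρ𝔤 : G21.lie →ₗ⁅ℝ⁆ Module.End ℂ V} (h : IsCohUnitaryIrrep ρK ρ𝔤)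
    {V' : Type} [AddCommGroup V'] [Module ℂ V']
    {ρK' : Representation ℂ G21.maximalCompact V'} {ρ𝔤' : G21.lie →ₗ⁅ℝ⁆ Module.End ℂ V'} (h' : IsCohUnitaryIrrep ρK' ρ𝔤')
    (δ : ℤ) (hδ : δ = 1 ∨ δ = -1)
    (hV : upqTypeClasses ρK ρ𝔤 h.gk.ad_compat 1 δ ≠ ⊥) (hV' : upqTypeClasses ρK' ρ𝔤' h'.gk.ad_compat 1 δ ≠ ⊥) :
    AreGKEquivalent ρK ρ𝔤 ρK' ρ𝔤' := by
  obtain ⟨Vp, _, _, ρKp, ρ𝔤p, hp, Vm, _, _, ρKm, ρ𝔤m, hm, -, -, -, hrig⟩ := archCohomologicalMembers_holds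
  rcases hrig V ρK ρ𝔤 h δ hδ hV with ⟨rfl, e⟩ | ⟨rfl, e⟩
  · rcases hrig V' ρK' ρ𝔤' h' 1 (Or.inl rfl) hV' with ⟨-, e'⟩ | ⟨h1, -⟩
    · exact e.trans e'.symm'
    · exact absurd h1 (by norm_num)
  · rcases hrig V' ρK' ρ𝔤' h' (-1) (Or.inr rfl) hV' with ⟨h1, -⟩ | ⟨-, e'⟩
    · exact absurd h1 (by norm_num)
    · exact e.trans e'.symm'

/-! ## §2 The class `[J^δ]` of record -/

/-- **`[J^δ] ∈ Cinf` — the archimedean `H¹`-member of type `δ` AS A CLASS**: the `(𝔤, K)`-isomorphism class of an irreducible unitary cohomological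
`(𝔲(2,1), K)`-module with a non-zero degree-one class of type `δ = ±1` (a chosen witness of EXIT 1; the class does not depend on the choice, by
`ofModule_eq_archDegOneClass`).  In print: `J⁺_φ`, `J⁻_φ` at `φ = φ(1,0,−1)`, the non-tempered members `πⁿ(ξ_ι)` of the archimedean A-packets
[§12.3 p. 178]. [cite: Rogawski1990, §12.3 p. 178; KnappVogan1995, §II.4] -/
def archDegOneClass (δ : ℤ) (hδ : δ = 1 ∨ δ = -1) : GKIrrClass G21 :=
  GKIrrClass.mk (exists_gkIrrep_of_sign δ hδ).choose

/-- **Specification**: `archDegOneClass δ` is the class of SOME irreducible unitary cohomological module with a non-zero degree-one class of type `δ`.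
[cite: Rogawski1990, Prop. 15.2.1 (b)] -/
theorem archDegOneClass_spec (δ : ℤ) (hδ : δ = 1 ∨ δ = -1) :
    ∃ (r : GKIrrep G21) (h : IsCohUnitaryIrrep r.ρK r.ρ𝔤),
      upqTypeClasses r.ρK r.ρ𝔤 h.gk.ad_compat 1 δ ≠ ⊥ ∧ GKIrrClass.mk r = archDegOneClass δ hδ :=
  ⟨_, (exists_gkIrrep_of_sign δ hδ).choose_spec.choose, (exists_gkIrrep_of_sign δ hδ).choose_spec.choose_spec, rfl⟩

/-- **CANONICITY — every `H¹`-member of type `δ` has class `[J^δ]`**: an irreducible unitary cohomological `(𝔲(2,1), K)`-module with a non-zero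
degree-one class of type `δ` has `(𝔤, K)`-class `archDegOneClass δ` (EXIT 2 rigidity + ★ `GKIrrClass.mk_eq_mk_iff`).
[cite: Rogawski1990, Prop. 15.2.1 (b); BorelWallach2000, VI Thm 4.11] -/
theorem ofModule_eq_archDegOneClass {V : Type} [AddCommGroup V] [Module ℂ V]
    (ρK : Representation ℂ G21.maximalCompact V) (ρ𝔤 : G21.lie →ₗ⁅ℝ⁆ Module.End ℂ V) (h : IsCohUnitaryIrrep ρK ρ𝔤)
    (δ : ℤ) (hδ : δ = 1 ∨ δ = -1) (hV : upqTypeClasses ρK ρ𝔤 h.gk.ad_compat 1 δ ≠ ⊥) :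
    GKIrrClass.ofModule V ρK ρ𝔤 h.gk h.irred = archDegOneClass δ hδ := by
  obtain ⟨r, hr, hrV, hr_eq⟩ := archDegOneClass_spec δ hδ
  rw [← hr_eq, GKIrrClass.ofModule_eq_mk, GKIrrClass.mk_eq_mk_iff]
  exact areGKEquivalent_of_upqType_ne_bot h hr δ hδ hV hrV

/-- **`[J⁺] ≠ [J⁻]`** (T6a purity ★ `hol_antihol_inequivalent`, read on classes). [cite: Rogawski1990, Prop. 15.2.1 (b); BorelWallach2000, VI Thm 4.11] -/
theorem archDegOneClass_one_ne_neg_one :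
    archDegOneClass 1 (Or.inl rfl) ≠ archDegOneClass (-1) (Or.inr rfl) := by
  obtain ⟨rp, hp, hpV, hp_eq⟩ := archDegOneClass_spec 1 (Or.inl rfl)
  obtain ⟨rm, hm, hmV, hm_eq⟩ := archDegOneClass_spec (-1) (Or.inr rfl)
  rw [← hp_eq, ← hm_eq, Ne, GKIrrClass.mk_eq_mk_iff]
  exact hol_antihol_inequivalent hp hm hpV hmV

/-- **The sign is determined by the class**: `archDegOneClass δ = archDegOneClass δ′ → δ = δ′`. [cite: Rogawski1990, Prop. 15.2.1 (b)] -/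
theorem archDegOneClass_injective {δ δ' : ℤ} (hδ : δ = 1 ∨ δ = -1) (hδ' : δ' = 1 ∨ δ' = -1)
    (heq : archDegOneClass δ hδ = archDegOneClass δ' hδ') : δ = δ' := by
  rcases hδ with rfl | rfl <;> rcases hδ' with rfl | rfl
  · rfl
  · exact absurd heq archDegOneClass_one_ne_neg_one
  · exact absurd heq.symm archDegOneClass_one_ne_neg_one
  · rfl

/-- **The `πⁿ`-half of the integrator's law `ArchPacketCoh`, as a THEOREM**: if an irreducible unitary cohomological module has class `[J^δ]`, then every
non-zero degree-one class on it is of type `δ` («the degree-one classes of type `δ′` on `πⁿ(ξ_ι) = J^δ` force `δ′ = δ`»).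
[cite: Rogawski1990, Prop. 15.2.1 (b); BorelWallach2000, VI Thm 4.11] -/
theorem eq_of_ofModule_eq_archDegOneClass {V : Type} [AddCommGroup V] [Module ℂ V]
    (ρK : Representation ℂ G21.maximalCompact V) (ρ𝔤 : G21.lie →ₗ⁅ℝ⁆ Module.End ℂ V) (h : IsCohUnitaryIrrep ρK ρ𝔤)
    {δ : ℤ} (hδ : δ = 1 ∨ δ = -1) (hcl : GKIrrClass.ofModule V ρK ρ𝔤 h.gk h.irred = archDegOneClass δ hδ)
    (δ' : ℤ) (hδ' : δ' = 1 ∨ δ' = -1) (hV' : upqTypeClasses ρK ρ𝔤 h.gk.ad_compat 1 δ' ≠ ⊥) : δ' = δ :=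
  archDegOneClass_injective hδ' hδ ((ofModule_eq_archDegOneClass ρK ρ𝔤 h δ' hδ' hV').symm.trans hcl)

/-- **Class-level read-back of EXIT 1 ∧ EXIT 2**: the classes of the irreducible unitary cohomological `(𝔲(2,1), K)`-modules with a non-zero degree-one
class of type `δ` form the singleton `{[J^δ]}`. [cite: Rogawski1990, Prop. 15.2.1 (b)] -/
theorem setOf_degOneClass_eq_singleton (δ : ℤ) (hδ : δ = 1 ∨ δ = -1) :
    {c : GKIrrClass G21 | ∃ (r : GKIrrep G21) (h : IsCohUnitaryIrrep r.ρK r.ρ𝔤),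
        upqTypeClasses r.ρK r.ρ𝔤 h.gk.ad_compat 1 δ ≠ ⊥ ∧ GKIrrClass.mk r = c} = {archDegOneClass δ hδ} := by
  ext c
  simp only [Set.mem_setOf_eq, Set.mem_singleton_iff]
  constructor
  · rintro ⟨r, hr, hrV, rfl⟩
    rw [← GKIrrClass.ofModule_eq_mk r.V r.ρK r.ρ𝔤 hr.gk hr.irred]
    exact ofModule_eq_archDegOneClass r.ρK r.ρ𝔤 hr δ hδ hrV
  · rintro rfl
    exact let ⟨r, hr, hrV, he⟩ := archDegOneClass_spec δ hδ; ⟨r, hr, hrV, he⟩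

end Summit.HodgeConjecture.HodgeConjecture.Cruxes.H413.F0P3bArchDegOneClass

end
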